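import Literature.MathematicalPhysics.QuantumFieldTheory.Balaban1983to89.B14Sect3

/-!
# `Balaban1983to89.B14Carve35Sect3ProofHyp` — [Balaban1988Convergent] Sect. 3, pp. 264–285 [PDF 22–43] («3. The k+1-st
# Renormalization Transformation and the Proof of Theorem 2», (3.1)–(3.72)): THE HYPOTHESIS-FORM BUNDLE OF CARVING BLOCK 35,
# keyed to the density-level currency of the Theorem of p. 245 (`Step.DensityRGI`, `B14.ThmP245PrintedI`) and to Theorem 2's
# family currency (`B14.Sect2Data`, `B14Sect3.Rep367` ∕ `Rep244`)

statement-level skeleton of published theorems with citation tags; proofs where landed; nothing here is a claim about the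
Yang–Mills mass gap

SOURCE.  T. Bałaban, *Convergent renormalization expansions for lattice gauge theories*, Commun. Math. Phys. **119** (1988)
243–285, doi:10.1007/bf01217741 [`Balaban1988Convergent`] (cell paper "B14" = [III] of the large-field papers; held
`paper:balaban1988-cmp119-convergent-renormalization`, journal page = PDF page + 242; its [I] = [Balaban1987RG1] (B12), [II] =
[Balaban1988RG2Cluster] (B13), "[16]" = [Balaban1985UV3] (B10), "[15]" = [Balaban1985Variational] (B11), "[14]" =
[Balaban1985RegularSpaces] (B8), "[13]" = [Balaban1985BackgroundPropagators] (B9), "[12]" = [Balaban1985Averaging] (B7)).  Pages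
264–285 were read first-hand for this file on the text layer (`lit read … --pages 22-43`; displays garbled) AND on the page renders
`run/shared/lean/pub/pub-balaban/b2b-balaban-ref1/pages/1988-cmp119-convergent-renormalization/…-p037-x2.png` (p. 279) and
`…-p041-x2.png` (p. 283) for the two sentences the bundle's slots quote.  STATUS of the source: published, refereed; the series' end
statement is a CLAIM UNDER ADJUDICATION by the audit cell `pub-balaban`.

WHY THIS FILE (cell `lit-balaban`, P6 CARVING FAN of D-0154 (3b); seat `lit-balaban-carve-09` g3, assigned block 35 by the cell lead's
RULING #7 (5) ∕ RULING #8 (`run/shared/lean/pub/lit-balaban/carve/STATUS.md` 2026-08-28T07:30:58Z); block row 35 of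
`carve/BLOCKS-31-40.md` = `carve/CARVE-LIST.md` §4 Block 35, rules `carve/CARVE-RULES.md`; KEY item `stmt-QuantumFields-20542`
(K1⁷ `StabilityBAtRecordR13SepCoPH`), also-feeds `stmt-QuantumFields-20544`).  The block is Sect. 3 in full — 22 pages, displays
(3.1)–(3.72).  At statement level this stretch is IN THE TREE (cell SKELETON: 35 rows — 20 proved, 6 typed-existing, 6 proved-existing, 3
typed; 1 748 in-tree declarations in 221 files cite a locator in the range, CARVE-LIST §4; the B14 lineage alone has ≈ 110 modules on
Sect. 3) — so, by the fan's rule «IN TREE = CITE, NEVER RESTATE» (CARVE-RULES §2.3), this file (a) RESTATES NOTHING: every printed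
statement of the block that has a declaration is cited BY NAME below (table + census); (b) finds, after a sentence-by-sentence census of
pp. 264–285 against the tree (below), NO printed statement of the block without an in-tree home — the block's residual is EMPTY
(CARVE-LIST §4 Block 35: «RESIDUAL candidates: none by display label (65 labels seen)»; its nine constants∕dependency clauses and three
claim cues are each located below); (c) conjoins the section's two printed THEOREM-LEVEL deliveries, BY NAME and over the currencies the
consumer side reads them in, into ONE hypothesis bundle `Hyp` over a FAMILY of runs `i : I` (Theorem 2's printed uniformity «E₁
independent of j, k, Ω, {Ω_j}, {Λ_j}, T»): the (k+1)-st transformation delivers the inductive description at k+1 (p. 279 — the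
Theorem of p. 245 for the run, `B14.ThmP245PrintedI`, the name the NODE 00 records cite), and the per-point representations behind
(2.43) and (2.44) ((3.67) p. 283 and p. 283's 𝐑-side sentence, `B14Sect3.Rep367` ∕ `Rep244` with constants BEFORE the run index) —
with the kernel-checked bookkeeping print performs on them: «Summing over z … we get the inequality (2.43) … this yields the
inequality (2.44). The proof of Theorem 2 is completed» (`Hyp.thm2`, landing EXACTLY in `B14.Thm2Printed` with β = 1 − β′), and the
induction along (0.2) to [III] Theorem 1 p. 262 modulo the base and the assumed 𝐑 of p. 244 (`Hyp.inductiveAssumptions`, `Hyp.thm1`).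

## The block's SKELETON rows → the in-tree declarations this file CITES (never restates)

(module prefix `…Balaban1983to89.` dropped; «H» = hypothesis-form `Prop`, «T» = theorem, «D» = definition∕structure, «M» = module)

| row | print | in tree | used here |
|---|---|---|---|
| B14.Eq3.1 | (3.1) p. 264 | D `Step.DensityRG` ∕ `Step.DensityRGI` (the sequence (0.2) with its operations T, 𝐑), `Step.TkOps`; p. 264 after (3.1) *«the new fields V_{k+1} satisfy the bounds |V_{k+1}(∂p′) − 1| < 2L²ε_k for p′ ∈ Γ_k^{(1)}»*: H `B14.Claim264.Claim264Printed`, PROVED `B14.Claim264.Claim264Printed_holds` | carrier `D i` of field `Hyp.tStep` |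
| B14.Eq3.2-3.4 | (3.2)–(3.4) p. 265 (the decompositions of unity on (Z′^{~4}_k)ᶜ and (B^{k+1}(P¹_{k+1}))^{~−1}; V_□^{(k)} = M^k((U_{k+1,□})₀), δ_k = g_kA₁∕A₀·p₀(g_k)) | T `B14Sect1Sets.decompUnity`; M `B14ArgField36Lattice` ((3.3): `top_sub_le_of_eq33`, `norm_ratio_gaugeAct_sub_one`) | cited |
| B14.Eq3.5 | (3.5) p. 265, Ω_{k+1} = (Q′^{~2}_{k+1} ∪ (B^{k+1}(P¹_{k+1})ᶜ)~)ᶜ | T `B14DomainGeom.omega35_subset_compl_enl`, `omega35_subset_lambda0`, `enl_compl_enl_subset_compl` | cited |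
| B14.Claim@265 | pp. 265–266, (3.6)–(3.9): *«Now we prove that on Ω^~_{k+1} the functions χ^{ax} and χ_k are equal to 1»* | H `B14Sect3.Ineq37Printed` (the chain (3.7); T `ineq37Printed_of_first`, `ineq37_coeff_conclusion` — v4 coefficient reading), H `B14Sect3.Ineq38Printed` ((3.8); T `ineq38Printed_of_first`), H `B14.Ineq39.Ineq39Printed` ((3.9)); M `B14ArgField36Lattice` (*«it can be bounded by 4δ_k»*: `argField36_lt_printed`), M `B14Ineq38Proof`, `B14Ineq38From190`, `B14From190ConcreteC` (*«Thus χ_k(□) = 1 for □ ⊂ Ω^~_{k+1}»*, *«Thus χ^{ax}((Ω^~_{k+1})^{(k)}) = 1»*) | cited |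
| B14.Eq3.10-3.11 | (3.10)–(3.11) p. 266 with *«This minimum is given by V^{(k)} = M^k(U_{k+1}) …»* | H `B14.Sect3Decomp.Claim310`, PROVED `B14.Claim310TwoStage.claim310_background` ∕ `claim310_of_twoStage` | cited |
| B14.Claim@267 | p. 267, (3.12)–(3.14) and *«This implies that |V′_k − 1| < O(1)ε_k on Ω_{k+1} … |A_k| < O(1)ε_k also»* | T `B14Sect3.ineq314_of`; H `B14.Ineq313.Ineq313Printed` ((3.13) by Lemma 1 [14]), M `B14Hyp313Discharge`; M `B14Ineq319Proof` (the O(1)ε_k conclusion), `B14.Eq316` (`|A_k|`) | cited |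
| B14.Eq3.15 | (3.15) pp. 267–268 | D `B14.Eq315Repr.Repr315Data`, H `B14.Eq315Repr.Eq315` | cited |
| B14.Eq3.16 | (3.16) p. 268 | D `B14.Eq316.SmallFluct`, `chiK`, `chiKc` (+ T `chiK_eq_one_iff`) | cited |
| B14.Eq3.17-3.19 | (3.17)–(3.19) pp. 268–269 | T `B14Sect3.ineq319_scalar`; M `B14Ineq319Proof`, `B14Ineq319From190`; T `B14Sect3.exp_neg_R_le_pow` (p. 269 *«bounded on the set S_{k+1} by O(1)ε_k exp(−R_k), hence by any positive power of g_k»*); M `B14.Eq322Analytic` (*«H^{(k)} is an analytic function of the background field U_{k+1} restricted to Λ^c_{k+1}∩Λ_k»*) | cited |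
| B14.Eq3.20 | (3.20) p. 269 + the box modification | T `B14DomainGeom.lambda320_far_from_compl`, `lambda320_subset_innerN`; M `B14BoxFix`, `B14BoxFixWall` | cited |
| B14.Eq3.21-3.22 | (3.21)–(3.22) p. 269 | D `B14.Eq316.chi321`; M `B14.Eq321Concrete`, `B14Eq322From190` | cited |
| B14.Eq3.23-3.25 | (3.23)–(3.25) p. 270 (𝐓^{(k+1)}, E^{(k)}, ρ′_{k+1}) | D `Step.TkOps` (field `ofOneStep`), M `B14Eq325CondIntegral`, `B14Eq325Split`; NODE 00 side: `Node00/TStepOfRecord`, `Node00/TkWeightsOfRecord` | carrier `(D i).T` of field `Hyp.tStep` |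
| B14.Def§3.Rsplit | pp. 270–271 (𝐑′_k into E_k by covariance, 𝐑″_k, k₁) | D `B14.RSplit.covCond`, M `B14.RSplitCovariance` | cited |
| B14.Eq3.26-3.32 | (3.26)–(3.32) pp. 271–273 (the s, t, t′ interpolations, the measures (3.27)∕(3.29), (3.31), (3.32)) | H `B14.Interpolation.Eq326`, `Eq330`, D `tiltedSum`; M `B14.Eq326Measure`, `B14InterpolationMeasure`, `B14InterpolationMgf`, `B14.Eq328Printed`, `B14.Eq328GaussianIBP`, `B14Eq328SharpCutoff`, `B14.Eq329Family`, `B14.Eq330Printed`, `B14.Eq331ChainRule` | cited |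
| B14.Eq3.33-3.36 | (3.33)–(3.36) pp. 273–274 | T `B14.GaussianDet333.eq333`, M `B14Eq333Proof`; T `B14Sect3.resolvent_identity_335`, `integral_resolvent_scalar`, `logdet_scalar_336_corrected` — and the located SIGN ERRATUM of (3.36): T `B14Sect3.logdet_scalar_336_printed_sign_fails` (cell DIVERGENCE D-pv02.5); M `B14LogDet336Matrix` (`eq336_corrected`), `B14.Eq334Contour`, `B14.Eq334SpectralWindow` (the λ₀ window, cell GAPS G-B14s-11) | cited |
| B14.Eq3.37-3.39 | (3.37)–(3.39) p. 274 (E₀^{(k+1)}(Λ_{k+1}, b); (3.38); gauge invariance and the covariance (3.39)) | M `B14.Eq338Localization`, `B14.Eq338Concrete`, `B14.Eq339Covariance` | cited |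
| B14.Eq3.40 | (3.40) p. 275, *«They form a decomposition of unity: Σ_z h_z = 1»* | D `B14Sect3.tent`, T `B14Sect3.tent_partition_unity`; M `B14Seam245` (`partial_unity_le_one`) | cited |
| B14.Eq3.41-3.42 | (3.41)–(3.42) p. 275 | D `B14.Eq338Localization.E0site`, T `sum_E0site`, `eq342`; T `B14.Eq339Covariance.E0site_transport` (*«it satisfies the inductive assumption (2.29) for j = k+1»*) | cited |
| B14.Eq3.43 | (3.43) + pp. 275–277 (the covers by 2MLʲη-cubes on the layers Ω_j∖Ω_{j+1}, *«we repeat all the considerations of Sect. 3.7 [I], with minor changes … We describe here briefly these changes and additions only»*, Lemmas 5, 6 [I] with (3.43)) | M `B14Radii`, `B14Space343`, `B14.LettersScaleN` ∕ `B14LettersScaleNLocal` ∕ `B14LettersScaleNLocalPieces` (*«all the formulas and bounds of Sects. 3, 4 [I] with η replaced by L⁻ⁿ»*), `B14.TkImagesAnalyticity`; cell GAPS G-B14s-12 … G-B14s-19 (the by-reference clauses) travel with `B14Sect3`'s docstring | cited |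
| B14.Eq3.44-3.47 | (3.44)–(3.47) pp. 277–278 (the exponentiated cluster expansion of Sect. 7 [I]: H′(Z₀)·H(Z₁)⋯, Z₀ᶜ, 𝐄^{(k+1)}(Λ_{k+1}, Z₀), the Mayer resummation; *«The terms of the sum above satisfy the bounds (2.42), with the constant B₀ replaced by O(p₁(g_k))»*) | M `B14Eq344PolymerRatio` (`num344`, `domsWith`), `B14.Eq347Letters`, `B14.Eq347Torus`; `B9Locality.RWModel.locClass` (CARVE-LIST's locator match) | cited |
| B14.Def§3.p279 | pp. 278–279: *«the terms 𝐄₀^{(k+1)}(Λ_{k+1}, X, z) … for X ⊂ Λ_{k+1}, do not depend on Λ_{k+1}, and coincide with the corresponding terms arising from the expressions defined on the whole lattice»*; the definition of 𝐄^{(k+1)}(X, z), 𝐑″^{(k+1)}, 𝐁^{(k+1)}; *«These terms satisfy all the conditions of the inductive assumption»*; the two renormalizations | H `Step.LFNewTerms` (the new-term obligations of the step, clause level), `Step.LFNewTermsB`, `Step.LFNewCov`; M `B14.Def3p279Step` — WITH BODY: D `ePart`∕`eRest`∕`rPart`∕`rRest`∕`bCollect`∕`logFluct`∕`EkStep`∕`stepRecord`,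 T `coupling_renormalization`, `vacuum_renormalization`, and the printed conclusion PROVED as an identity of the (2.23) actions: T `B14.Def3p279Step.step_identity`, `exp_step_identity`; M `B14.Def2Ek` (`−E_k + E^{(k)} = −E_{k+1}`); M `B14DeltaBeta`, `B14Eq344PolymerRatio`, `B14FlowStepPerturbed` (*«do not depend on Λ_{k+1}»*) | the density-level SUMMARY of all of pp. 264–279 is field `Hyp.tStep` (`B14.ThmP245PrintedI`); the clause level is the consumer's `Scorr` (NODE 00: `Sect2.LawsT = Step.LFHyp ∧ Step.LFNewTerms ∧ LFHypAnalytic`) |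
| B14.Eq3.48 | (3.48) p. 280 with *«the sum over X is bounded by O(1)exp(−κ(LʲL⁻ⁿ)⁻¹) ≦ O(1)(LʲL⁻ⁿ)⁵»* | T `B14Sect3.exp_split_348`, `exp_neg_mul_le_pow_inv`, `exp_neg_inv_le_pow_five`; M `B14.Eq348ClassGeometry`, `B14.Eq348SecondClass`, `B14.Eq348TorusClasses` | cited |
| B14.Eq3.49-3.50 | (3.49)–(3.50) p. 280 | H `B14.Eq350Kernel.Eq349`; M `B14.Eq349WardReduction` (`eq349_abstract`, `eq349_of_record`), `B14.Eq349Remainder`, `B14.Eq349IrrelevantFeed`, `B14.Eq350KernelCauchy`, `B14.LettersScaleN` | cited |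
| B14.Lem@280 | (3.51)–(3.54) pp. 280–281 (*«We prove the following antisymmetry property»*, *«because A is an arbitrary matrix»*) | T `B14Sect3.sum_antisymm_pair`, `antisymm_of_pairing_symm_zero`, D `B14Sect3.lam353` with T `fwdDiff_lam353_half` — and the located coefficient slip of (3.53): T `B14Sect3.fwdDiff_lam353_printed_fails` (cell DIVERGENCE D-pv02.7); M `B14.Lem280Ward`, `B14.Lem280WardLie`, `B14.Lem280WardSuN` | cited |
| B14.Eq3.55-3.57 | (3.55)–(3.57) p. 281 (*«This function is translation invariant, hence Π^{(j)}_{μν,κλ} is independent of z»*) | T `B14Sect3.sum_antisymm_two_pairs`; M `B14.Eq356FieldStrength`, `B14.Eq356ExtensionFeed`, `B14.Eq357ExtensionZd`, `B14.Eq357KernelDecay`, `B14.Eq358TranslInv` | cited |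
| B14.Eq3.58-3.61 | (3.58)–(3.61) p. 282 | H `B14.Eq358TranslInv.Eq358Refl`, `Eq358Perm`; D `B14Sect3.axisSign`, T `refl_invariant_vanish`, `perm_invariant_diag`, `invariant_tensor_361`; M `B14.Eq358Covariance`, `B14.Eq358ModelInstance`, `B14.Eq360TensorInvariance`, `B14.Eq361Scalar` | cited |
| B14.Eq3.62-3.64 | (3.62)–(3.64) pp. 282–283 (*«This is the required equality»*) | T `B14Sect3.beta_resum_362`; H `B14.Eq364Beta.Eq363`; M `B14.Eq362KernelWard`, `B14.Eq362Marginals`, `B14.Eq363SummedKernel`, `B14.Eq364Beta`, `B14.Eq364Symmetries` (`ward_divergence_of_paired`: *«the identity (I.4.15) again»*) | cited |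
| B14.Eq3.65-3.66 | (3.65)–(3.66) p. 283 | T `B14.TentUnity.weightedAction_decomposition`, M `B14.TentUnityTorus`, `B14.Eq366ActionF2`, `B14.Eq366Irrelevant` | cited |
| B14.Eq3.67 | (3.67) p. 283 ⇒ (2.43) | H `B14Sect3.Rep367`; T `B14Sect3.pointSum_le`, `B14Sect3.ineq243_of_rep367` (*«Summing over z ∈ Λ_j⁰∩Ω w[e] get the inequality (2.43) in Theorem 2 (with 1 − β, β > 0, instead of β < 1)»*); M `B14.Eq367Assembly` (`rep367_of_pointData`, `ineq243_of_pointData` — every step print performs between (3.56) and (3.67)); H `B14Thm2.Ineq243` | field `Hyp.rep367`; `Hyp.ineq243`, `Hyp.thm2` |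
| B14.Claim@283R | p. 283, proof of (2.44) (*«we stop at the identity (3.49) … all the terms on the right-hand side can be bounded by O(1)(LʲL⁻ⁿ)⁴g_j^{κ₀}exp(−κd_j(X)), and this yields the inequality (2.44). The proof of Theorem 2 is completed»*) | H `B14Sect3.Rep244`; T `B14Sect3.ineq244_of_rep244`, `thm2_conjuncts_of_reps`; M `B14.Claim283RBound` (`perPointR_of_eq349`), `B14.Claim283RAnalytic`, `B14.Ineq244ChartFeed`, `B14.Thm2Assembly`; H `B14Thm2.Ineq244`, H `B14.Thm2Printed` (T `B14Thm2.thm2Printed_iff`) | field `Hyp.rep244`; `Hyp.ineq244`, `Hyp.thm2` |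
| B14.Claim@283alt | pp. 283–284, (3.68)–(3.72), the sketched second proof | H `B14Sect3.Ineq368Printed` with T `ineq368_corrected` — and the located DEFECT: T `B14Sect3.ineq368_printed_fails` (the printed chain (3.68) fails as printed; corrected form proved); M `B14.Eq369ThirdOrder` (`taylor3_integral_remainder`), `B14.Eq372ContourBCH` | cited ONLY — a sketch *«Finally, let us sketch briefly another proof of Theorem 2»*, not load-bearing; deliberately NOT a bundle slot |

## Census of the REMAINING printed statements of pp. 264–285 (every sentence that asserts something, page by page)

* p. 264 l. 1–24 ((2.47)–(2.49), Corollary 3 (2.50) and its proof sentence) — Sect. 2, block 34 (`B14Thm2.Ineq247`, `B14Thm2.bound248_of_247`,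
  `B14Thm2.Ineq249`, `B14Cor3.*`, `B16.Cor3_250` ∕ `B16.Cor3With`): boundary of the block, cited only.
* p. 264 l. 25–30 (the section's programme: *«We apply the next renormalization transformation to the density ρ_k, and we study the generation
  of the new density, and especially the terms 𝐄^{(k+1)}, 𝐑^{(k+1)}, 𝐁^{(k+1)}, E^{(k+1)}. The inductive assumptions and Theorem 2 are proved for
  these terms. Almost all operations and bounds were studied in the previous papers [16, I], so we concentrate only on new issues.»*) — the
  two deliveries of the block = the two halves of `Hyp` (`tStep`; `rep367` ∕ `rep244` with `Hyp.thm2`).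
* p. 264 after (3.1) (*«the restrictions introduced by the characteristic function χ_k imply that the new fields V_{k+1} satisfy the bounds
  |V_{k+1}(∂p′) − 1| < 2L²ε_k»*; Z′_k, Z′^{~4}_k) — `B14.Claim264.Claim264Printed` ∕ `Claim264Printed_holds` (PROVED), `B14DomainGeom`: cited.
* p. 265 (the constructions (3.2)–(3.5): P_{k+1}, P′_{k+1}, the axial gauge *«as in (1.5), with V_k, ε_k, g_k instead of U, ε₀, g₀»*, P¹_{k+1},
  *«We get an expansion of the form (1.6)»*, Q_{k+1}, Q′_{k+1}, δ_k, Ω_{k+1}, *«On the domain Ω^~_{k+1} there are only the small field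
  characteristic functions»*) — definitions∕narrative over `B14Sect1Sets`, `B14DomainGeom`, `B14.Eq218SeqSucc` (`snoc`, `extOf`): cited.
* p. 266 l. 1–18 (the chain behind (3.6)–(3.9), incl. *«On almost the whole cube □^{~4}, except a boundary layer of the width 2Mγ, the field …
  can be bounded by 4δ_k. On the boundary layer this field can be bounded by 30d²L²B₃(1 + β₀)ε_k by an application of the inequality (1.65)
  from [14], or rather by an application of the reasoning leading to that inequality. By the exponential decay property (190) [15] we obtain
  the estimate (3.7) for A₁∕A₀ and γ sufficiently small»*, *«and for A₁∕A₀ sufficiently small»*) — row B14.Claim@265: cited (CARVE-LIST's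
  constants clauses p.266:L12 ∕ L18 = the explicit restriction binders of `B14Sect3.ineq37_scalar` ∕ `ineq38_scalar` ∕ `B14.Ineq39`; cue
  p.266:L9 = the first member of `Ineq37Printed`, by reference to (1.65) [14] ∕ (190) [15] — cell GAPS C-adv5-92 (b) on the coefficient «4δ_k»).
* p. 266 l. 19 – p. 267 l. 14 ((3.10)–(3.14) with *«On the domain Ω_{k+1} we introduce a fluctuation field as in [16]»*, *«The restrictions on
  the fields V_k, V_{k+1} on Ω^~_{k+1}, and Theorem 1 from [16] imply, that U_{k+1} satisfies the following regularity condition (3.12)»*,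
  *«Applying Lemma 1 [14] we obtain (3.13)»*) — rows B14.Eq3.10-3.11, B14.Claim@267: cited (cell GAPS G-B14s-06: the multi-domain minimizers
  *«as in [16]»*).
* p. 267 l. 15 – p. 268 l. 3 (the resummation ζ(Ω_{k+1}) — *«We represent this sum as a sum over admissible domains Ω_{k+1}, and for a fixed
  Ω_{k+1} we resum over admissible sets P_{k+1}, Q_{k+1}»*; *«The next steps are exactly the same as in Sect. C [16], and in fact the same as in
  Sect. 2 [I] … All the applied formulas are the same as in Sect. 2 [I], only the symbols represent different operators, determined by the
  sequence {Ω_j}. Their properties are essentially the same as before»*; (3.15)) — `B14.Eq315Repr` (the representation with its data record),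
  `Node00/StepWeightsOfRecord` ∕ `StepWeightsAtThresholds` (ζ(Ω_{k+1}) of record, 53 + 50 declarations): cited (CARVE-LIST clause p.268:L8 =
  the motivating sentence for (3.16), no claim).
* p. 268 l. 4 – p. 269 l. 2 ((3.16)–(3.19): *«The first is equal to 1, because of the bound on A_k introduced by the second … This follows from
  the identity analogous to (3.6), (3.17)»*; *«the argument of the function H_{k+1,□} is bounded by 44d²B₃³ε_{k+1}, and has a support in a
  boundary layer of the width 2LMγ»*; (3.18); *«These facts, and the bounds (106)–(108), (159)–(163) in [12], imply (3.19) for g_k, or γ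
  sufficiently small»*) — row B14.Eq3.17-3.19: cited (CARVE-LIST clause p.269:L2 = the smallness binder of `B14Sect3.ineq319_scalar`).
* p. 269 l. 3 – p. 270 l. 2 (R_{k+1}, (3.20), the box modification *«if a component is contained in a cube of the size 100LMR_{k+1}, then we
  replace it by the smallest rectangular parallelepiped containing it»* (`B14BoxFix`; its located subtlety `single_pass_fails`), (3.21), the
  determining set and the change of variables (1.21)–(1.23), *«H^{(k)} is an analytic function … bounded on the set S_{k+1} by O(1)ε_k
  exp(−R_k), hence by any positive power of g_k»*, V^{(k)}(S_{k+1}, A_k, H^{(k)}), the sums over Λ_{k+1} and S_{k+1}) — rows B14.Eq3.20,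
  B14.Eq3.21-3.22: cited.
* p. 270 ((3.23)–(3.25); *«Now the fundamental problem is to represent the logarithm of the last fluctuation field integral in the form
  described by the inductive assumption, i.e. as the sum of three terms 𝐄^{(k+1)} + 𝐑^{(k+1)} + 𝐁^{(k+1)} satisfying the inductive assumption
  … Therefore we need the improved statements and bounds for these terms, discussed before the formulation of Theorem 1, but we obtain such
  improvements quite naturally»*) — row B14.Eq3.23-3.25 and the `Scorr` («corresponding assumptions», improved) slot of `B14.ThmP245PrintedI`:
  cited; it is what `Hyp.tStep` summarises.
* p. 270 l. 30 – p. 271 l. 8 (the covariance split of 𝐑_k at k₁ — *«the largest integer satisfying L^{−(k−k₁)}MR_j ≦ L»* —, *«It has the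
  same covariance property as the expression determined by 𝐄_k, and we include it into 𝐄_k»*) — row B14.Def§3.Rsplit: cited.
* pp. 271–273 ((3.26)–(3.32) and every sentence sorting the three expressions of (3.26) ∕ (3.28) into 𝐁^{(k+1)}, 𝐑^{(k+1)}, 𝐄^{(k+1)}: *«The
  first … contributes to 𝐁^{(k+1)} only. The second … contributes to 𝐑^{(k+1)} and 𝐁^{(k+1)}. The third … contributes to 𝐄^{(k+1)} and
  𝐁^{(k+1)}»*; *«The first expression on the right-hand side of (3.28) … contributes to 𝐁^{(k+1)} only»*; the expansion in t·g_k, (3.30);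
  *«They can be expressed as inner products of functional derivatives … (3.31)»*; (3.32)) — row B14.Eq3.26-3.32 and `B14.Def3p279Step.bCollect`:
  cited (the identities (3.26)–(3.33) certified by hand, cell GAPS C-B14s-02; typed measure-level in `B14.Eq326Measure` ∕ `B14.Eq328GaussianIBP`).
* pp. 273–274 ((3.33)–(3.38): *«The last term is a number, which contributes to the vacuum energy renormalization, so we include it into the
  definition of E₀^{(k)}»*; (3.34) with the contour γ; *«We take λ₀ > r, but small enough»*; *«The integral of the first term on the right-hand
  side is equal to −½ log λ₀I. The second term is O(|z|⁻²)»*; (3.36); the definition (3.37); *«The identities (3.30)–(3.33), (3.36), together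
  with the above definition, imply the equality (3.38)»*; *«The terms in (3.38) are gauge invariant. If they are constructed assuming that
  Λ_{j+1} is the whole space … then they are also Euclidean covariant, and we have (3.39) … The Euclidean covariance (3.39) follows from the
  transformation laws (2.29), (2.32), and from the definitions of the expressions in (3.37)»*) — rows B14.Eq3.33-3.36, B14.Eq3.37-3.39: cited
  (sign erratum of (3.36) settled by `B14Sect3.logdet_scalar_336_printed_sign_fails` ∕ `…_corrected`; λ₀ uncited in print — cell GAPS G-B14s-11,
  `B14.Eq334SpectralWindow`).
* p. 275 ((3.40)–(3.42); *«This function has the same properties as the function (3.37), namely it is gauge invariant, and, when defined on the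
  whole lattice, it is Euclidean covariant, i.e. it satisfies the inductive assumption (2.29) for j = k + 1»*; *«The functions 𝐄₀^{(k+1)}(z) are
  not equal yet to the functions 𝐄^{(k+1)}(z) in the inductive assumptions. These are obtained by constructing localized expansions»*) — rows
  B14.Eq3.40, B14.Eq3.41-3.42: cited.
* pp. 275–278 (the cluster expansions BY REFERENCE — *«To construct their cluster expansions we repeat all the considerations of Sect. 3.7 [I],
  with minor changes connected with the boundary layers {Ω_j∖Ω_{j+1}}, and additions connected with the new terms in the effective action.
  We describe here briefly these changes and additions only»*; the 2^d-cube covers of the layers; *«for terms connected with such a cube □,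
  we obtain all the formulas and bounds of Sects. 3, 4 [I] with η replaced by L⁻ⁿ. In fact we have better bounds»*; *«we apply Theorems
  3.7–3.10 [13] in their full generality»*; *«we obtain Lemmas 5, 6 [I] with the corresponding changes … with analyticity space (1.6.34)
  replaced by the space (3.43)»*; the actions of (3.27), (3.29) (*«the analysis presented in [16] for three-dimensional models is enough
  here»*; *«To its terms we apply the formulas (3.6), (3.7) [I]»*); p. 277 *«This is the reason for putting the powers of 1∕2 in the
  conditions (2.36)–(2.39). The analyticity domains become smaller after each step, but the difference is very small and exponentially
  decreasing in the number of steps»*; *«The terms of the expansion can be estimated as in (2.42), but with the additional factor O(ε_k)»*;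
  the g_k⁻²(·) − g_k⁻² terms *«supp(g_k⁻²(·) − g_k⁻²) ⊂ Z_k»*; V^{(k)}(S_{k+1}); (3.44)–(3.47) with *«Z_i ⊂ Z₀ᶜ, where Z₀ᶜ is the union of all cubes
  from π_k such that they do not intersect Z₀, or intersect it along a two-dimensional edge at most»* (CARVE-LIST cue p.278:L5), *«The terms
  of the sum above satisfy the bounds (2.42), with the constant B₀ replaced by O(p₁(g_k))»*, the second and first integrals of (3.37)) — rows
  B14.Eq3.43, B14.Eq3.44-3.47: cited; the by-reference clauses are cell GAPS G-B14s-12 … G-B14s-19 ∕ C-B14s-01 … C-B14s-06 (in `B14Sect3`'s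
  docstring), `B14.TkImagesAnalyticity` (the ½-powers of (2.36)–(2.39)), `B14Radii` ∕ `B14Space343` (p₁(g_k), (3.43)).
* p. 278 l. 40 – p. 279 l. 33 — row B14.Def§3.p279 (CARVE-LIST clauses p.278:L42, p.279:L20, p.279:L43): cited; the printed conclusion
  *«After this we obtain Tρ_k represented exactly in the form described by the inductive assumption with k + 1 instead of k. This ends the
  inductive proof of this representation.»* is the slot `Hyp.tStep` at density level (`B14.ThmP245PrintedI`, whose docstring quotes it) and is
  PROVED as an identity of the (2.23) actions at clause level (`B14.Def3p279Step.step_identity`); *«Let us remark that they are not the terms in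
  the k+1-st effective action, because we have to perform yet the 𝐑-operation»* = `B14.RAssumedP244` (p. 244; the hypothesis `hR` of
  `Hyp.inductiveAssumptions` ∕ `Hyp.thm1`).
* p. 279 l. 34 – p. 280 l. 8 (the proof of Theorem 2 opens: *«Here we want to achieve a more extensive goal than just the proof …»*; the basic
  difference 𝐄^{(j)}(Λ_j, U_k, z) − 𝐄^{(j)}(Λ_j, 1, z); the two cases (I.3.5); (3.48) and *«In the proof of Theorem 2 we simply estimate all these
  terms using the above bound, and the sum over X is bounded by O(1)exp(−κ(LʲL⁻ⁿ)⁻¹) ≦ O(1)(LʲL⁻ⁿ)⁵. This is an admissible error contributing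
  only to the constant on the right-hand side of (2.43)»*) — row B14.Eq3.48: cited (CARVE-LIST clause p.279:L43 *«U_k may depend on the
  fluctuation field, as in the exponential in (3.15)»* = the generality binder of `B14.Eq348ClassGeometry` ∕ `Rep367`'s ω).
* p. 280 l. 9 – p. 281 l. 30 (the first case: (3.3), (3.18)–(3.28) [I] *«have a bit different meaning now … the difference is seen in bounds
  only»*; *«for the proof of Theorem 2 we put H_k(B′) = 0 in (I.3.28), or A = 0 in (I.3.30)»*; (1.3.32)∕(1.3.34)∕(1.3.54)∕(1.3.35) with η ↦ L⁻ⁿ;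
  the Ward–Takahashi identities (I.4.14), (I.4.15) *«we move the factors B to the point z instead of the point x»*; (3.49), (3.50) and *«This
  implies 𝐄^{(2)}_{μν}(X, x, y, z) = 𝐄^{(2)}_{νμ}(X, y, x, z)»*; the Lemma (3.51) with its proof (3.52)–(3.54) *«by the first identity (I.4.15).
  Because A is an arbitrary matrix, so the above equalities imply E^{(s)} = 0»*; (3.55); (3.56) with *«(the irrelevant terms) … denotes the sum
  of terms which can be bounded by O((LʲL⁻ⁿ)^{5−β})exp(−κd_j(X)), where β is a positive number»*; the resummation over X ⊂ □^{~2} and the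
  extension to all X ∈ 𝐃_j of L^{−j}ℤ^d *«The difference between the two sums contributes to the irrelevant terms only, by the bounds (3.48)»*;
  (3.57); *«This function is translation invariant, hence Π^{(j)}_{μν,κλ} is independent of z»*) — rows B14.Eq3.49-3.50, B14.Lem@280,
  B14.Eq3.55-3.57: cited (CARVE-LIST clause p.281:L35 = `B14.Eq358TranslInv`).
* p. 282 ((3.58)–(3.63): *«The notation here is confusing …»* — the two readings of r; (3.59); *«the above covariance together with the first
  Ward–Takahashi identity (I.4.15) imply (3.60)»*; *«Considering reflections we conclude that in this case the coefficients in the sum are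
  different from 0 only if μ = ν and κ = λ. Considering permutations we conclude that then they are all equal»* ⇒ (3.61); *«The last identity
  can be considered as a possible definition of the β-function. Now we prove that it coincides with the definition (1.1.22)»*; (3.62) *«Using
  the translation invariance and the identity (I.4.15) again»*; (3.63) from (2.26) and (1.1.20), (1.5.1)) — rows B14.Eq3.58-3.61,
  B14.Eq3.62-3.64: cited.
* p. 283 l. 1–20 ((3.64) *«This is the required equality»*; (3.65) with h_z on T_{L^{−j}} and *«For z ∈ Λ_j⁰ we have h_zφ_j = h_z, and the
  function A(h_z, U_j) is Euclidean covariant»*; (3.66); *«Thus the first expression … cancels the expression on the right-hand side of (3.61),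
  and we are left with the irrelevant terms only. To get the expressions needed in the fluctuation field integral, we differentiate these
  terms with respect to the parameter t_□»*; (3.67) and the summation sentence; *«Thus we have proved the first part of Theorem 2, concerning
  the functions 𝐄^{(j)}»*) — rows B14.Eq3.65-3.66, B14.Eq3.67: cited; `Hyp.rep367`, `Hyp.ineq243`.
* p. 283 l. 21–27 (the 𝐑-side and *«The proof of Theorem 2 is completed»*) — row B14.Claim@283R: cited; `Hyp.rep244`, `Hyp.ineq244`,
  `Hyp.thm2` (CARVE-LIST cues p.283:L21 ∕ L22 ∕ L28 = these sentences and the head of the second proof).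
* p. 283 l. 28 – p. 284 l. 30 (the second proof: the two classes X ⊂ □^{~n−j} ∕ X ∩ (□^{~n−j})ᶜ ≠ ∅ with *«2E₀exp(−½κ(n−j))exp(−½κd_j(X)),
  and exp(−½κ(n−j)) < (LʲL⁻ⁿ)⁵»*; □₀, the axial gauge of Sect. F [15]; (3.68); *«The third order terms are already irrelevant by the above
  bound, hence (3.69)»*; (3.70), (3.71); the gauge change and (3.72) *«This assures that both terms on the right-hand side above are of the
  order O((LʲL⁻ⁿ)²)»*; *«The main term equals Σ_{κ<μ}(x_κ − z_κ)F_{κμ}(z) … the remainder can be estimated by O(1)(LʲL⁻ⁿ)³»*; *«The remaining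
  arguments are as in the first proof»*; *«The above proof can be also elaborated to a complete renormalization procedure … but it is
  important to notice that it works only if we have the representation (2.26), (2.27) with the corresponding properties, similarly as the
  first proof»*) — row B14.Claim@283alt: cited ONLY (a sketch; (3.68) as printed FAILS, `B14Sect3.ineq368_printed_fails`, corrected form
  `ineq368_corrected`; `B14.Eq369ThirdOrder`, `B14.Eq372ContourBCH`); nothing here relies on it.
* p. 285: acknowledgements and references [I], [II] — no statement.

RESULT OF THE CENSUS: NO printed statement of pp. 264–285 lacks an in-tree declaration; the block's residual is EMPTY and this file
types NO new `…Printed` statement.  Three printed displays of the block stand CORRECTED in the tree, by theorems, and are cited in their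
corrected reading, never restated: the sign of (3.36) (`B14Sect3.logdet_scalar_336_printed_sign_fails`), the coefficient of (3.53)
(`B14Sect3.fwdDiff_lam353_printed_fails`) and the chain (3.68) (`B14Sect3.ineq368_printed_fails`); and the coefficient «4δ_k» of (3.7)'s first
member carries the located reading of cell GAPS C-adv5-92 (b) (`B14Sect3.ineq37_coeff_conclusion`).

STANDING SMALLNESS (cell lead RULING #9, `carve/STATUS.md` 2026-08-28T07:49:36Z — a reading rule for blocks 30–36).  Every statement of
Sect. 3 sits under [III] Theorem 1's clause, p. 262 [PDF 20, text layer p0020.txt:L32–L36] *«if the sequence of coupling constants {g_k},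
determined by the recursive renormalization group (Callan-Symanzik) equations (0.18), (0.20) [I], satisfies the inequalities (I.0.33)»*, and
Theorem 2's *«Under the assumptions of Theorem 1»* (p. 263 [PDF 21, p0021.txt:L9]).  In THIS file the smallness of the couplings enters every
bundle field ONLY through the explicitly displayed hypotheses `(fam i).flow.SatisfiesRG (fam i).K → H033 (fam i).flow (fam i).K → …` — the
shape of record of `B14.Thm1Printed` ∕ `B14.Thm2Printed` (the cell's parameter `H033` for the unresolved «(I.0.33)», instantiated by consumers
as `B14.H033Interval γ` ∕ `B14.H033LogRunning …`) —, so no standing-smallness parameter occurs unthresholded and RULING #9 (2)'s binder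
`∃ a > 0, ∀ ε, 0 < ε → ε ≤ a → …` has no place to go here (no new `…Printed` statement is typed); `β′` (print's *«β > 0»* of (3.67)) and `κ₀`
are exponents, `L` the scale factor.  The block's LOCAL smallness clauses — p. 266 [p0024.txt:L12] *«for A₁∕A₀ and γ sufficiently small»*
(after (3.7)), p. 266 [L18] *«and for A₁∕A₀ sufficiently small»* (after (3.9)), p. 269 l. 1 [p0027.txt:L2] *«for g_k, or γ sufficiently small»*
(after (3.19)), p. 273 [p0031.txt:L33] *«We take λ₀ > r, but small enough»* (before (3.35)) — qualify displays that are PROVED ∕ typed in the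
sibling modules of rows B14.Claim@265, B14.Eq3.17-3.19 and B14.Eq3.33-3.36 (with explicit thresholds there) and are cited with them, not typed
here.

## What is here
* §1 `Hyp Pm avm D Ssp Scorr H033 fam L β′ κ₀` — ONE `Prop`-valued structure over a FAMILY of runs `i : I` (one gauge group `G`; per run
  the lattice parameters `Pm i`, the averaging operations `avm i`, the step datum `D i : Step.DensityRGI` — densities ρ_k, operations T_k,
  𝐑_k with the step law (0.2) —, the index-k spaces `Ssp i k` ∕ the «corresponding assumptions» `Scorr i k` of p. 262, and the Theorem-2 datum
  `fam i : B14.Sect2Data` carrying K, the flow and the terms of (2.43)∕(2.44); Theorem 1's flow hypotheses `SatisfiesRG` + `H033` as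
  printed guards), conjoining BY NAME: `tStep i` = pp. 264–279 summarised by p. 279's sentence, in the density-level currency
  `B14.ThmP245PrintedI (D i).T (D i).ρ (Ssp i) (Scorr i) (fam i).K` (the Theorem of p. 245 for the run — the name the NODE 00 records cite);
  `rep367` = (3.67) p. 283 as the representation hypothesis `B14Sect3.Rep367 (fam i) L c β′` with ONE constant `c ≥ 0` BEFORE the run index
  (Theorem 2's printed uniformity); `rep244` = p. 283's 𝐑-side sentence as `B14Sect3.Rep244 (fam i) L c′ κ₀`, likewise uniform.
* §2 kernel-checked bookkeeping out of `Hyp` (no statement asserted): `Hyp.ineq243` ∕ `Hyp.ineq244` — per run, (2.43) with β = 1 − β′ and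
  E₁ = c, (2.44) with R₁ = c′ (`B14Sect3.ineq243_of_rep367` ∕ `ineq244_of_rep244`, the printed summation over z); ★ `Hyp.thm2` — *«The
  proof of Theorem 2 is completed»*: the bundle yields `B14.Thm2Printed H033 fam L (1 − β′) κ₀` EXACTLY (family form, constants before the run
  index; `B14Thm2.thm2Printed_iff`), given `0 < L` and non-negative couplings; `Hyp.inductiveAssumptions` — p. 279 *«This ends the inductive
  proof of this representation»* along (0.2): with the start `Ssp i 0 (ρ₀)` ([III] Thm 1's ρ₀, block 34) and the assumed 𝐑 of p. 244
  (`B14.RAssumedP244`, delivered by [IV]∕[V] = blocks 36–40) every ρ_k, k ≦ K, lies in the index-k space (`B14.inductiveAssumptions_of_thmP245I`);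
  ★ `Hyp.thm1` — [III] Theorem 1 p. 262 for the run (`B14.Thm1Printed H033 (fam i)`), modulo the same two inputs and the binding `hIA` of the
  abstract inductive assumption to space membership (`B14.thm1Printed_of_thmP245I`); `hyp_of_parts` (the constructor displayed).

## HONEST SCOPE — what is NOT claimed
Nothing of [B14] is proved here and no `…Printed` statement is asserted: `Hyp` is a HYPOTHESIS bundle; the theorems are bookkeeping
between typed shapes (the siblings' point-counting summation, an `Iff.rfl` re-packaging, one induction on k ≦ K).  The content of Sect. 3
— that Bałaban's T-operation, multi-domain minimizers, conditional integrals and cluster expansions DO deliver `ThmP245PrintedI` and the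
representations (3.67) ∕ p. 283 — is exactly what the bundle assumes; most of it is stated in print BY REFERENCE to [I], [16], [13], [14],
[12] (cell GAPS G-B14s-02 … G-B14s-21), and the target space of the p. 245 Theorem is specified in print only qualitatively (G-pv04-1; the
`Scorr` slot is abstract here and instantiated by consumers, e.g. NODE 00's `Sect2.LawsT = Step.LFHyp ∧ Step.LFNewTerms ∧ LFHypAnalytic`).
The cell's rows travel with the cited names (G-B14s-06 minimizers «as in [16]», G-B14s-11 λ₀, G-pv01-1 (ii) the termwise proof of (2.44),
D-pv02.5∕D-pv02.7 the two errata, G2 the unresolved «(I.0.33)» = the parameter `H033`).  No summit statement is proved by this seat; K1⁷ is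
NOT discharged; the file moves no node count; one lattice paper at finite K — nothing continuum ∕ ℝ⁴ ∕ OS ∕ mass-gap ∕ Clay.  No `sorry`, no
`instance`, no `notation`, no attribute manipulation; imports `…B14Sect3` (hence `…B14`, `…B14Thm2`, `…Step`, `…StepInhabited`, `…Setup`) only.
-/

namespace Literature.MathematicalPhysics.QuantumFieldTheory.Balaban1983to89.B14Carve35Sect3ProofHyp

/-! ## §1 The block-35 hypothesis bundle -/

/-- **BLOCK 35 OF [B14] — SECT. 3 — AS ONE HYPOTHESIS BUNDLE** (pp. 264–285 [PDF 22–43]) over a family of runs `i : I` (one gauge group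
`G`; per run: lattice parameters `Pm i`, averaging operations `avm i`, the step datum `D i` of (0.2) — *«ρ_k = 𝐑Tρ_{k−1} = (𝐑T)^kρ₀»* —, the
index-k spaces `Ssp i k` = *«the assumptions described in detail in Sect. 2»* with index k and `Scorr i k` = *«the corresponding
assumptions»* of a T-image (p. 262: *«the newly created expressions 𝐄^{(k)}, 𝐑^{(k)}, 𝐁^{(k)} are defined on slightly larger spaces … and they
have better decay properties»*), the Theorem-2 datum `fam i : B14.Sect2Data`; Theorem 1's flow hypotheses — *«{g_k}, determined by …
(0.18), (0.20) [I], satisfies the inequalities (I.0.33)»* — as the printed guards `SatisfiesRG`, `H033`), conjoining BY NAME the section's two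
theorem-level deliveries (p. 264: *«The inductive assumptions and Theorem 2 are proved for these terms»*):
`tStep` = **pp. 264–279, the (k+1)-st renormalization transformation** — p. 279 [PDF 37] verbatim: *«Thus we have finished the
decomposition of the logarithm of the fluctuation field integral in (3.25) into the sum of the three terms: 𝐄^{(k+1)}, 𝐑″^{(k+1)}, and
𝐁^{(k+1)}. These terms satisfy all the conditions of the inductive assumption. … After this we obtain Tρ_k represented exactly in the form
described by the inductive assumption with k + 1 instead of k. This ends the inductive proof of this representation.»* — in the density-level
currency of the Theorem of p. 245 (*«Theorem. If ρ_k satisfies the assumptions described in detail in Sect. 2, then Tρ_k satisfies also the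
corresponding assumptions.»*; `B14.ThmP245PrintedI`, sequence reading over the inhabited carrier, for the run, k < K);
`rep367` = **(3.67) p. 283** verbatim: *«𝐄^{(j)}(Λ_j, U_k, z) − 𝐄^{(j)}(Λ_j, 1, z) − β_jA(h_z, U_k) = O((LʲL⁻ⁿ)^{5−β}), (3.67) for z ∈
Λ_j⁰∩(Ω_n∖Ω_{n+1}), β > 0»* as the representation hypothesis `B14Sect3.Rep367` of the left-hand side of (2.43), with ONE constant `c ≥ 0`
before the run index (Theorem 2 p. 263: *«a constant E₁ independent of j, k, Ω, {Ω_j}, {Λ_j}, T»*);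
`rep244` = **p. 283** verbatim: *«The inequality (2.44) for the functions 𝐑^{(j)} can be proved in an almost identical way. We analyze these
functions as above, but we stop at the identity (3.49), where 𝐄^{(2)}(X, x, y, z) is replaced by 𝐑^{(2)}(X, x, y), and z is an arbitrary
point from X. Now all the terms on the right-hand side can be bounded by O(1)(LʲL⁻ⁿ)⁴g_j^{κ₀}exp(−κd_j(X)), and this yields the inequality
(2.44).»* as `B14Sect3.Rep244`, likewise with one `c′ ≥ 0` (*«an absolute constant R₁»*).
The displays (3.1)–(3.66) and (3.68)–(3.72) are PROVED ∕ BODIED ∕ typed as inputs of these in the sibling modules of the module docstring's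
table and take no slot.  Hypothesis slot only; nothing asserted.
[cite: Balaban1988Convergent, §3 p.264 (programme), p.279 (end of the construction) with Theorem p.245, (3.67) p.283, p.283 (proof of (2.44))] -/
structure Hyp {I : Type} {G : Type*} [GaugeGroup G] [MeasurableSpace G] [HaarData G]
    (Pm : I → Params) (avm : (i : I) → (j : ℕ) → Averaging (Pm i) j G)
    (D : (i : I) → Step.DensityRGI (Pm i) G (avm i))
    (Ssp Scorr : (i : I) → (k : ℕ) → Density (Pm i) k G → Prop)
    (H033 : Flow → ℕ → Prop) (fam : I → B14.Sect2Data) (L β' : ℝ) (κ₀ : ℕ) : Prop where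
  /-- pp. 264–279 ∕ p. 279 «This ends the inductive proof of this representation» — in tree: `B14.ThmP245PrintedI` (the Theorem of
  p. 245 for the run), under Theorem 1's flow hypotheses. -/
  tStep : ∀ i : I, (fam i).flow.SatisfiesRG (fam i).K → H033 (fam i).flow (fam i).K →
    B14.ThmP245PrintedI (D i).T (D i).ρ (Ssp i) (Scorr i) (fam i).K
  /-- (3.67) p. 283 — in tree: `B14Sect3.Rep367`, with Theorem 2's uniform constant. -/
  rep367 : ∃ c : ℝ, 0 ≤ c ∧ ∀ i : I, (fam i).flow.SatisfiesRG (fam i).K → H033 (fam i).flow (fam i).K →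
    B14Sect3.Rep367 (fam i) L c β'
  /-- p. 283, the 𝐑-side of the proof of Theorem 2 — in tree: `B14Sect3.Rep244`, with Theorem 2's absolute constant. -/
  rep244 : ∃ c' : ℝ, 0 ≤ c' ∧ ∀ i : I, (fam i).flow.SatisfiesRG (fam i).K → H033 (fam i).flow (fam i).K →
    B14Sect3.Rep244 (fam i) L c' κ₀

/-! ## §2 Bookkeeping (kernel-checked uses of the cited declarations; no statement asserted) -/

section Proj

variable {I : Type} {G : Type*} [GaugeGroup G] [MeasurableSpace G] [HaarData G]
  {Pm : I → Params} {avm : (i : I) → (j : ℕ) → Averaging (Pm i) j G}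
  {D : (i : I) → Step.DensityRGI (Pm i) G (avm i)}
  {Ssp Scorr : (i : I) → (k : ℕ) → Density (Pm i) k G → Prop}
  {H033 : Flow → ℕ → Prop} {fam : I → B14.Sect2Data} {L β' : ℝ} {κ₀ : ℕ}

/-- **p. 283: «Summing over z ∈ Λ_j⁰∩Ω w[e] get the inequality (2.43) in Theorem 2 (with 1 − β, β > 0, instead of β < 1)»** — per run
in the window, (2.43) in the typed form `B14Thm2.Ineq243` with exponent `1 − β′` and the family's constant `E₁ = c`, by the sibling's
point-counting summation `B14Sect3.ineq243_of_rep367` (needs `0 < L`). [cite: Balaban1988Convergent, (3.67) ⇒ (2.43) p.283 (bookkeeping)] -/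
theorem Hyp.ineq243 (h : Hyp Pm avm D Ssp Scorr H033 fam L β' κ₀) (hL : 0 < L) :
    ∃ E₁ : ℝ, 0 ≤ E₁ ∧ ∀ i : I, (fam i).flow.SatisfiesRG (fam i).K → H033 (fam i).flow (fam i).K →
      B14Thm2.Ineq243 (fam i) L (1 - β') E₁ := by
  obtain ⟨c, hc, H⟩ := h.rep367
  exact ⟨c, hc, fun i hrg h033 => B14Sect3.ineq243_of_rep367 (fam i) L c β' hL hc (H i hrg h033)⟩

/-- **p. 283: «and this yields the inequality (2.44)»** — per run in the window, (2.44) in the typed form `B14Thm2.Ineq244` with the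
family's absolute constant `R₁ = c′`, by `B14Sect3.ineq244_of_rep244` (needs `0 < L` and non-negative couplings `g_j ≥ 0` of the run).
[cite: Balaban1988Convergent, p.283 ⇒ (2.44) (bookkeeping)] -/
theorem Hyp.ineq244 (h : Hyp Pm avm D Ssp Scorr H033 fam L β' κ₀) (hL : 0 < L) (hg : ∀ (i : I) (j : ℕ), 0 ≤ (fam i).flow.g j) :
    ∃ R₁ : ℝ, 0 ≤ R₁ ∧ ∀ i : I, (fam i).flow.SatisfiesRG (fam i).K → H033 (fam i).flow (fam i).K →
      B14Thm2.Ineq244 (fam i) R₁ κ₀ := by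
  obtain ⟨c', hc', H⟩ := h.rep244
  exact ⟨c', hc', fun i hrg h033 => B14Sect3.ineq244_of_rep244 (fam i) L c' κ₀ hL hc' (hg i) (H i hrg h033)⟩

/-- **p. 283: «The proof of Theorem 2 is completed.» — located**: the bundle's two representation slots yield **Theorem 2 p. 263 EXACTLY
as typed in the family form `B14.Thm2Printed H033 fam L β κ₀` with β = 1 − β′** (constants E₁ = c, R₁ = c′ quantified BEFORE the run index, the
printed *«independent of j, k, Ω, {Ω_j}, {Λ_j}, T»*; the printed guard *«for β < 1»* becomes vacuous bookkeeping since β′ > 0 is not needed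
for the summation), by `B14Thm2.thm2Printed_iff` and the two projections above.  Inputs beyond the bundle: `0 < L` and `g_j ≥ 0` (the
couplings are positive under every instantiation of «(I.0.33)», e.g. `B14.H033Interval`).  Bookkeeping; nothing of Bałaban's asserted.
[cite: Balaban1988Convergent, Thm 2 (2.43)-(2.44) p.263 with p.283 (bookkeeping)] -/
theorem Hyp.thm2 (h : Hyp Pm avm D Ssp Scorr H033 fam L β' κ₀) (hL : 0 < L) (hg : ∀ (i : I) (j : ℕ), 0 ≤ (fam i).flow.g j) :
    B14.Thm2Printed H033 fam L (1 - β') κ₀ := by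
  rw [B14Thm2.thm2Printed_iff]
  intro _
  obtain ⟨E₁, -, hE⟩ := h.ineq243 hL
  obtain ⟨R₁, -, hR⟩ := h.ineq244 hL hg
  exact ⟨E₁, R₁, fun i hrg h033 => ⟨hE i hrg h033, hR i hrg h033⟩⟩

/-- **p. 279 «This ends the inductive proof of this representation», along (0.2)**: for a run `i` in Theorem 1's window, the bundle's T-step
together with the START in the index-0 space ([III] Thm 1 p. 262 *«ρ₀ = exp[−(1∕g₀²)A − E]»* — block 34's row; hypothesis `h0`) and the
ASSUMED 𝐑 of p. 244 (*«We will not describe it here, we will only assume that it has some properties incorporated in the inductive description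
of the effective actions»* — `B14.RAssumedP244`, hypothesis `hR`; constructed in [IV]∕[V] = blocks 36–40) puts every `ρ_k`, k ≦ K, in the
index-k space (`B14.inductiveAssumptions_of_thmP245I`). [cite: Balaban1988Convergent, p.279 with (0.2) p.244 and p.262 (bookkeeping)] -/
theorem Hyp.inductiveAssumptions (h : Hyp Pm avm D Ssp Scorr H033 fam L β' κ₀) (i : I)
    (hrg : (fam i).flow.SatisfiesRG (fam i).K) (h033 : H033 (fam i).flow (fam i).K)
    (h0 : Ssp i 0 ((D i).ρ 0)) (hR : B14.RAssumedP244 (D i).R (Scorr i) (Ssp i) (fam i).K) :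
    ∀ k, k ≤ (fam i).K → Ssp i k ((D i).ρ k) :=
  B14.inductiveAssumptions_of_thmP245I (D i) h0 (h.tStep i hrg h033) hR

/-- **[III] Theorem 1 p. 262 for a run of the family, modulo the base and the assumed 𝐑** — verbatim: *«There exist constants … such that if
the sequence of coupling constants {g_k} … satisfies the inequalities (I.0.33), then the sequence of densities {ρ_k}, generated by successive
applications of the operations 𝐑T to the density ρ₀ = exp[−(1∕g₀²)A − E], satisfies all the inductive assumptions»* (`B14.Thm1Printed H033
(fam i)`): from the bundle's T-step, the start `hbase`, the assumed 𝐑 `hR` (both under the flow hypotheses, as print has them) and the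
binding `hIA` of the datum's abstract inductive assumption to membership in the index-k space (the consumer's dictionary, e.g. NODE 00's
`Sect2FormOfRecord`), by `B14.thm1Printed_of_thmP245I`.  Bookkeeping; nothing analytic. [cite: Balaban1988Convergent, Thm 1 p.262 with Theorem p.245 and p.279 (bookkeeping)] -/
theorem Hyp.thm1 (h : Hyp Pm avm D Ssp Scorr H033 fam L β' κ₀) (i : I)
    (hIA : ∀ k, k ≤ (fam i).K → Ssp i k ((D i).ρ k) → (fam i).InductiveAssumption k)
    (hbase : (fam i).flow.SatisfiesRG (fam i).K → H033 (fam i).flow (fam i).K → Ssp i 0 ((D i).ρ 0))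
    (hR : (fam i).flow.SatisfiesRG (fam i).K → H033 (fam i).flow (fam i).K →
      B14.RAssumedP244 (D i).R (Scorr i) (Ssp i) (fam i).K) :
    B14.Thm1Printed H033 (fam i) :=
  B14.thm1Printed_of_thmP245I H033 (fam i) (D i) (Ssp i) (Scorr i) hIA hbase (h.tStep i) hR

/-- **The section's programme sentence p. 264 — «The inductive assumptions and Theorem 2 are proved for these terms» — as ONE conclusion for
the family**: Theorem 2 in its printed family form AND, for every run in the window with the start and the assumed 𝐑 supplied, [III]
Theorem 1's conclusion *«satisfies all the inductive assumptions»* for every k ≦ K.  Composition of `Hyp.thm2` and `Hyp.thm1`; bookkeeping.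
[cite: Balaban1988Convergent, §3 p.264 (programme) with Thm 1 p.262, Thm 2 p.263 (bookkeeping)] -/
theorem Hyp.programme (h : Hyp Pm avm D Ssp Scorr H033 fam L β' κ₀) (hL : 0 < L)
    (hg : ∀ (i : I) (j : ℕ), 0 ≤ (fam i).flow.g j)
    (hIA : ∀ (i : I) (k : ℕ), k ≤ (fam i).K → Ssp i k ((D i).ρ k) → (fam i).InductiveAssumption k)
    (hbase : ∀ i : I, (fam i).flow.SatisfiesRG (fam i).K → H033 (fam i).flow (fam i).K → Ssp i 0 ((D i).ρ 0))
    (hR : ∀ i : I, (fam i).flow.SatisfiesRG (fam i).K → H033 (fam i).flow (fam i).K →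
      B14.RAssumedP244 (D i).R (Scorr i) (Ssp i) (fam i).K) :
    B14.Thm2Printed H033 fam L (1 - β') κ₀ ∧ ∀ i : I, B14.Thm1Printed H033 (fam i) :=
  ⟨h.thm2 hL hg, fun i => h.thm1 i (hIA i) (hbase i) (hR i)⟩

end Proj

/-- **The bundle from its three named parts** (the constructor, displayed for consumers who hold the siblings' claims separately; the two
representation constants enter with their signs). [cite: Balaban1988Convergent, pp.264-283 (bookkeeping)] -/
theorem hyp_of_parts {I : Type} {G : Type*} [GaugeGroup G] [MeasurableSpace G] [HaarData G]
    (Pm : I → Params) (avm : (i : I) → (j : ℕ) → Averaging (Pm i) j G)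
    (D : (i : I) → Step.DensityRGI (Pm i) G (avm i))
    (Ssp Scorr : (i : I) → (k : ℕ) → Density (Pm i) k G → Prop)
    (H033 : Flow → ℕ → Prop) (fam : I → B14.Sect2Data) (L β' : ℝ) (κ₀ : ℕ)
    (hT : ∀ i : I, (fam i).flow.SatisfiesRG (fam i).K → H033 (fam i).flow (fam i).K →
      B14.ThmP245PrintedI (D i).T (D i).ρ (Ssp i) (Scorr i) (fam i).K)
    {c c' : ℝ} (hc : 0 ≤ c) (hc' : 0 ≤ c')
    (h367 : ∀ i : I, (fam i).flow.SatisfiesRG (fam i).K → H033 (fam i).flow (fam i).K → B14Sect3.Rep367 (fam i) L c β')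
    (h244 : ∀ i : I, (fam i).flow.SatisfiesRG (fam i).K → H033 (fam i).flow (fam i).K → B14Sect3.Rep244 (fam i) L c' κ₀) :
    Hyp Pm avm D Ssp Scorr H033 fam L β' κ₀ :=
  ⟨hT, ⟨c, hc, h367⟩, ⟨c', hc', h244⟩⟩

end Literature.MathematicalPhysics.QuantumFieldTheory.Balaban1983to89.B14Carve35Sect3ProofHyp
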